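import Mathlib
import Literature.NumberTheory.Transcendental.KZProduct
import Literature.NumberTheory.Transcendental.KZProductIdeal
import Literature.NumberTheory.Transcendental.KZSemiCanonicalReductionProofs
import Literature.NumberTheory.Transcendental.KZDominatedFamilyRelations
import Literature.NumberTheory.Transcendental.SemialgebraicMapsProofs
import Summits.KontsevichZagierPeriods.KontsevichZagierPeriods.Theorems.SoloInformedPolyJacobian
import Summits.KontsevichZagierPeriods.KontsevichZagierPeriods.Theorems.SoloInformedKZStokesCells
import Summits.KontsevichZagierPeriods.KontsevichZagierPeriods.Theorems.SoloInformedPiDiscQuarters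
import Summits.KontsevichZagierPeriods.KontsevichZagierPeriods.Theorems.SoloInformedPiDisc
import Summits.KontsevichZagierPeriods.KontsevichZagierPeriods.Theorems.SoloInformedDiscCancellation
import Summits.KontsevichZagierPeriods.KontsevichZagierPeriods.Theorems.SoloInformedRevolution
import Summits.KontsevichZagierPeriods.KontsevichZagierPeriods.Theorems.SoloInformedRevolutionFlatten
import Summits.KontsevichZagierPeriods.KontsevichZagierPeriods.Theorems.SoloInformedRevolutionPolar
import HarnessLib
import HarnessLib.Audit

/-!
# SoloInformed — solids of revolution, III: Pappus' theorem in the Kontsevich–Zagier calculus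

For a planar representation `K` of dimension `2` with compact domain contained in `{u ≥ 0}` we
prove **Pappus–Guldin inside the four-move calculus**

  `soloInformed_revRep_equivalent_piRep_prod_flatRep :
      Equivalent [Rev K, 1] [D̄ × Λ K, 1]`,

where `D̄` is the closed unit disc (`KZ.piRep`) and `Λ(u, z) = (u², z)`: a solid of revolution is
KZ-equivalent to the cylinder over its flattened profile; in particular
`vol(Rev K) = π · area(Λ K) = 2π ∫_K u du dz` (`soloInformed_value_revRep`). The moves, all with
`ℚ`-polynomial data: rule (1a) + three sign flips (`SoloInformedRevolution`); rule (2) for the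
polynomial cylindrical map `Φ` (`SoloInformedRevolutionPolar`); rule (2) for the stretching
`Ψ(s, ρ, z) = (s, ρ(1 + s²), z)` (`det Ψ' = 1 + s²`, this file) onto `(0,1) × (K ∩ {u > 0})` with
integrand `(1/(1+s²)) · 2u`, which is the product representation `[[0,1], 1/(1+s²)] × [K, 2u]`
up to a null set; rule (2) for `Λ` (`[K, 2u] ∼ [Λ K, 1]`, `SoloInformedRevolutionFlatten`); and
`[D̄, 1] − 4 · [[0,1], 1/(1+t²)] ∈ relations` (`SoloInformedPiDisc`) through the ideal property
of `relations` (`KZProductIdeal`).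

Consequence for the volume ladder (`SoloInformedVolumeLadder`, `SoloInformedDiscCancellation`):
**volume rung `3` holds for solids of revolution about a common axis**, granted the
Huber–Wüstholz theorem on curve periods (through volume rung `2`,
`soloInformed_volumeRung_le_two`): two such solids with equal volume are KZ-equivalent
(`soloInformed_revolution_equivalent_of_value_eq`). No disc cancellation is needed, since equal
volumes `π · area(Λ K) = π · area(Λ K')` already give `area(Λ K) = area(Λ K')`. The open content
of volume rung `3` (which implies `π² ∉ ℚ·log 2·log 3`, an open case of the weak four-exponentials
conjecture — residency paper Thm. II: a solid torus against the box
`{1 ≤ x ≤ 2, 1 ≤ y ≤ 3, 0 ≤ xyz ≤ 1}` of volume `log 2 · log 3`) therefore lies in comparing solids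
*across* such symmetry classes.

Residency `solo-KontsevichZagierPeriods-informed` (PLAN.md, session s16).
References: M. Kontsevich, D. Zagier, *Periods* (2001), §1.1–§1.2; Pappus–Guldin centroid
theorem, e.g. T. Apostol, *Calculus*, vol. II (1969), §11.29.
-/

noncomputable section

open MeasureTheory Set Filter
open scoped Topology

namespace Summit.KontsevichZagierPeriods.KontsevichZagierPeriods.Theorems

open Literature.NumberTheory.Transcendental Literature.NumberTheory.Transcendental.KZ
open Literature.ModelTheory.ExponentialFields (IsSemialgebraic isSemialgebraic_setOf_eval_le
  isSemialgebraic_setOf_eval_lt isSemialgebraic_setOf_eval_pos isSemialgebraic_setOf_eval_eq_zero)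

/-! ### Step 4: the stretching `Ψ(s, ρ, z) = (s, ρ(1 + s²), z)` onto `(0,1) × (K ∩ {u > 0})` -/

/-- The components of `Ψ` as polynomials. -/
def soloInformedStretchPoly : Fin 3 → MvPolynomial (Fin 3) ℚ :=
  ![MvPolynomial.X 0, MvPolynomial.X 1 * (1 + MvPolynomial.X 0 ^ 2), MvPolynomial.X 2]

/-- The stretching map `Ψ(s, ρ, z) = (s, ρ(1 + s²), z)`. -/
def soloInformedStretch : (Fin 3 → ℝ) → (Fin 3 → ℝ) := soloInformedPolyMap soloInformedStretchPoly

/-- First component of `Ψ`. -/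
@[simp] theorem soloInformedStretch_apply_zero (u : Fin 3 → ℝ) : soloInformedStretch u 0 = u 0 := by
  simp [soloInformedStretch, soloInformedStretchPoly]

/-- Second component of `Ψ`. -/
@[simp] theorem soloInformedStretch_apply_one (u : Fin 3 → ℝ) :
    soloInformedStretch u 1 = u 1 * (1 + u 0 ^ 2) := by
  simp [soloInformedStretch, soloInformedStretchPoly]

/-- Third component of `Ψ`. -/
@[simp] theorem soloInformedStretch_apply_two (u : Fin 3 → ℝ) : soloInformedStretch u 2 = u 2 := by
  simp [soloInformedStretch, soloInformedStretchPoly]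

/-- Jacobian determinant of `Ψ`: `det Ψ'(s, ρ, z) = 1 + s²`. -/
theorem soloInformed_det_stretch (u : Fin 3 → ℝ) :
    (soloInformedJacCLM soloInformedStretchPoly u).det = 1 + u 0 ^ 2 := by
  rw [soloInformed_det_jacCLM, Matrix.det_fin_three]
  simp [soloInformedJacMat_apply, soloInformedStretchPoly]

/-- The target `{0 < s < 1, 0 < u, (u, z) ∈ A}` of `Ψ`. -/
def soloInformedCylTgt (A : Set (Fin 2 → ℝ)) : Set (Fin 3 → ℝ) :=
  {x | 0 < x 0 ∧ x 0 < 1 ∧ 0 < x 1 ∧ (![x 1, x 2] : Fin 2 → ℝ) ∈ A}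

/-- The target is `ℚ`-semialgebraic. -/
theorem isSemialgebraic_soloInformedCylTgt {A : Set (Fin 2 → ℝ)} (hA : IsSemialgebraic ℚ A) :
    IsSemialgebraic ℚ (soloInformedCylTgt A) := by
  have h1 := isSemialgebraic_setOf_eval_lt (k := ℚ) (R := ℝ) (0 : MvPolynomial (Fin 3) ℚ)
    (MvPolynomial.X 0)
  have h2 := isSemialgebraic_setOf_eval_lt (k := ℚ) (R := ℝ)
    (MvPolynomial.X 0 : MvPolynomial (Fin 3) ℚ) 1
  have h3 := isSemialgebraic_setOf_eval_lt (k := ℚ) (R := ℝ) (0 : MvPolynomial (Fin 3) ℚ)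
    (MvPolynomial.X 1)
  have h4 := hA.preimage_aeval (![MvPolynomial.X 1, MvPolynomial.X 2] :
    Fin 2 → MvPolynomial (Fin 3) ℚ)
  have h := h1.inter (h2.inter (h3.inter h4))
  simp only [map_zero, map_one, MvPolynomial.aeval_X] at h
  have e : ∀ x : Fin 3 → ℝ, (fun j => MvPolynomial.aeval x ((![MvPolynomial.X 1,
      MvPolynomial.X 2] : Fin 2 → MvPolynomial (Fin 3) ℚ) j)) = (![x 1, x 2] : Fin 2 → ℝ) :=
    fun x => by
    ext j; fin_cases j <;> simp
  have hset : soloInformedCylTgt A = {x : Fin 3 → ℝ | 0 < x 0} ∩ ({x | x 0 < 1} ∩ ({x | 0 < x 1} ∩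
      (fun x : Fin 3 → ℝ => fun j => MvPolynomial.aeval x ((![MvPolynomial.X 1,
        MvPolynomial.X 2] : Fin 2 → MvPolynomial (Fin 3) ℚ) j)) ⁻¹' A)) := by
    ext x
    simp only [soloInformedCylTgt, mem_setOf_eq, mem_inter_iff, mem_preimage, e x]
  rw [hset]
  exact h

/-- The last two coordinates of a point of `ℝ¹⁺²`, as used by `IntegralRep.prodDomain`. -/
theorem soloInformed_natAdd_one_eq (x : Fin 3 → ℝ) :
    (fun j : Fin 2 => x (Fin.natAdd 1 j)) = ![x 1, x 2] := by
  ext j; fin_cases j <;> rfl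

/-- The product representation `[[0,1], 1/(1+s²)] × [K, 2u]`. -/
def soloInformedCylProdRep (K : IntegralRep 2) (hKc : IsCompact K.domain) : IntegralRep 3 :=
  soloInformedArctanRep.prod (soloInformedRadialRep K hKc)

/-- Membership in the domain of the product representation. -/
theorem soloInformed_mem_cylProdRep_domain (K : IntegralRep 2) (hKc : IsCompact K.domain)
    (x : Fin 3 → ℝ) : x ∈ (soloInformedCylProdRep K hKc).domain ↔
      (0 ≤ x 0 ∧ x 0 ≤ 1) ∧ (![x 1, x 2] : Fin 2 → ℝ) ∈ K.domain := by
  rw [soloInformedCylProdRep, IntegralRep.prod_domain, IntegralRep.mem_prodDomain,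
    soloInformed_natAdd_one_eq]
  simp [soloInformedUnitI]

/-- The integrand of the product representation is `(1/(1+s²)) · 2u`. -/
theorem soloInformed_cylProdRep_integrand (K : IntegralRep 2) (hKc : IsCompact K.domain)
    (x : Fin 3 → ℝ) : (soloInformedCylProdRep K hKc).integrand x = 1 / (1 + x 0 ^ 2) * (2 * x 1) := by
  rw [soloInformedCylProdRep, IntegralRep.prod_integrand_eq, IntegralRep.prodFun_apply,
    soloInformed_natAdd_one_eq]
  simp

/-- The target lies in the product domain. -/
theorem soloInformedCylTgt_subset (K : IntegralRep 2) (hKc : IsCompact K.domain) :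
    soloInformedCylTgt K.domain ⊆ (soloInformedCylProdRep K hKc).domain := by
  rintro x ⟨h0, h0', -, hmem⟩
  rw [soloInformed_mem_cylProdRep_domain]
  exact ⟨⟨h0.le, h0'.le⟩, hmem⟩

/-- The target representation `[(0,1) × (K ∩ {u > 0}), (1/(1+s²)) · 2u]` (a restriction of the
product representation). -/
def soloInformedCylTgtRep (K : IntegralRep 2) (hKc : IsCompact K.domain) : IntegralRep 3 :=
  (soloInformedCylProdRep K hKc).restrict (soloInformedCylTgt K.domain)
    (isSemialgebraic_soloInformedCylTgt K.isSemialgebraic_domain) (soloInformedCylTgt_subset K hKc)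

/-- **Step 4.** `[source, 2ρ(1+s²)] − [target, (1/(1+s²)) · 2u] ∈ relations` (rule (2) for `Ψ`). -/
theorem soloInformed_cylSrcRep_sub_tgtRep_mem_relations (K : IntegralRep 2)
    (hKc : IsCompact K.domain) :
    of (soloInformedCylSrcRep K hKc) - of (soloInformedCylTgtRep K hKc) ∈ relations := by
  refine changeOfVariablesRel_subset_relations ⟨3, soloInformedCylSrcRep K hKc,
    soloInformedCylTgtRep K hKc, soloInformedStretch, soloInformedJacCLM soloInformedStretchPoly,
    isSemialgebraicMapOn_aeval (isSemialgebraic_soloInformedCylSrc K.isSemialgebraic_domain)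
      soloInformedStretchPoly,
    fun u _ => (soloInformed_hasFDerivAt_polyMap soloInformedStretchPoly u).hasFDerivWithinAt,
    ?_, ?_, fun u hu => ?_, rfl⟩
  · intro u hu v hv huv
    obtain ⟨-, -, hu1, -⟩ := hu
    have e0 : u 0 = v 0 := by simpa only [soloInformedStretch_apply_zero] using congr_fun huv 0
    have e1 : u 1 * (1 + u 0 ^ 2) = v 1 * (1 + v 0 ^ 2) := by
      simpa only [soloInformedStretch_apply_one] using congr_fun huv 1
    have e2 : u 2 = v 2 := by simpa only [soloInformedStretch_apply_two] using congr_fun huv 2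
    rw [e0] at e1
    have hpos : (1 : ℝ) + v 0 ^ 2 ≠ 0 := by positivity
    have h1 : u 1 = v 1 := mul_right_cancel₀ hpos e1
    ext j
    fin_cases j
    · exact e0
    · exact h1
    · exact e2
  · ext x
    show x ∈ soloInformedCylTgt K.domain ↔ x ∈ soloInformedStretch '' soloInformedCylSrc K.domain
    constructor
    · rintro ⟨h0, h0', h1, hmem⟩
      have hpos : (0 : ℝ) < 1 + x 0 ^ 2 := by positivity
      refine ⟨![x 0, x 1 / (1 + x 0 ^ 2), x 2], ⟨?_, ?_, ?_, ?_⟩, ?_⟩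
      · simpa using h0
      · simpa using h0'
      · simp only [Matrix.cons_val_one]
        exact div_pos h1 hpos
      · have hw : x 1 / (1 + x 0 ^ 2) * (1 + x 0 ^ 2) = x 1 := div_mul_cancel₀ _ hpos.ne'
        show (![x 1 / (1 + x 0 ^ 2) * (1 + x 0 ^ 2), x 2] : Fin 2 → ℝ) ∈ K.domain
        rw [hw]
        exact hmem
      · have H0 : soloInformedStretch ![x 0, x 1 / (1 + x 0 ^ 2), x 2] 0 = x 0 := by
          rw [soloInformedStretch_apply_zero]
          simp
        have H1 : soloInformedStretch ![x 0, x 1 / (1 + x 0 ^ 2), x 2] 1 = x 1 := by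
          rw [soloInformedStretch_apply_one]
          simp only [Matrix.cons_val_zero, Matrix.cons_val_one]
          exact div_mul_cancel₀ _ hpos.ne'
        have H2 : soloInformedStretch ![x 0, x 1 / (1 + x 0 ^ 2), x 2] 2 = x 2 := by
          rw [soloInformedStretch_apply_two]
          simp
        ext j
        fin_cases j
        · exact H0
        · exact H1
        · exact H2
    · rintro ⟨u, ⟨h0, h0', h1, hmem⟩, rfl⟩
      refine ⟨by simpa using h0, by simpa using h0', ?_, ?_⟩
      · rw [soloInformedStretch_apply_one]
        positivity
      · rw [soloInformedStretch_apply_one, soloInformedStretch_apply_two]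
        exact hmem
  · obtain ⟨-, -, hu1, -⟩ := hu
    show 2 * u 1 * (1 + u 0 ^ 2) =
      (soloInformedCylProdRep K hKc).integrand (soloInformedStretch u) *
        |(soloInformedJacCLM soloInformedStretchPoly u).det|
    rw [soloInformed_cylProdRep_integrand, soloInformed_det_stretch, soloInformedStretch_apply_zero,
      soloInformedStretch_apply_one, abs_of_pos (by positivity)]
    have hpos : (1 : ℝ) + u 0 ^ 2 ≠ 0 := by positivity
    rw [one_div, inv_mul_eq_div, div_mul_cancel₀ _ hpos]
    ring

/-- **Step 4′.** `[[0,1] × K, (1/(1+s²)) · 2u] − [target, same] ∈ relations`: the difference of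
the domains lies in the planes `s = 0`, `s = 1`, `u = 0` (here `K ⊆ {u ≥ 0}` is used). -/
theorem soloInformed_cylProdRep_sub_tgtRep_mem_relations (K : IntegralRep 2)
    (hKc : IsCompact K.domain) (hK0 : K.domain ⊆ {y | 0 ≤ y 0}) :
    of (soloInformedCylProdRep K hKc) - of (soloInformedCylTgtRep K hKc) ∈ relations := by
  refine (soloInformedCylProdRep K hKc).of_sub_of_restrict_mem_relations
    (isSemialgebraic_soloInformedCylTgt K.isSemialgebraic_domain) (soloInformedCylTgt_subset K hKc) ?_
  have hax : ∀ (i : Fin 3) (c : ℝ), volume {u : Fin 3 → ℝ | u i = c} = 0 := fun i c => by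
    rw [volume_pi]; exact Measure.pi_hyperplane _ _ _
  refine measure_mono_null (fun x hx => ?_)
    (measure_union_null (measure_union_null (hax 0 0) (hax 0 1)) (hax 1 0))
  rcases hx with ⟨hxP, hns⟩
  rw [soloInformed_mem_cylProdRep_domain] at hxP
  obtain ⟨⟨h0, h0'⟩, hmem⟩ := hxP
  have hx1 : 0 ≤ x 1 := by simpa using hK0 hmem
  by_contra hc
  simp only [mem_union, mem_setOf_eq, not_or] at hc
  exact hns ⟨lt_of_le_of_ne h0 (Ne.symm hc.1.1), lt_of_le_of_ne h0' hc.1.2,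
    lt_of_le_of_ne hx1 (Ne.symm hc.2), hmem⟩

/-! ### Assembly: Pappus–Guldin in the calculus -/

/-- The first quarter of the solid is equivalent to `[[0,1], 1/(1+s²)] × [Λ K, 1]` in the formal
period ring: `[Q₁₁] − [[0,1], 1/(1+s²)] · [Λ K, 1] ∈ relations`. -/
theorem soloInformed_quarter_sub_arctan_mul_flat_mem_relations (K : IntegralRep 2)
    (hKc : IsCompact K.domain) (hK0 : K.domain ⊆ {y | 0 ≤ y 0}) :
    of (soloInformedRevQuarterRep 1 1 K hKc) -
      of soloInformedArctanRep * of (soloInformedFlatRep K hKc) ∈ relations := by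
  have h1 := soloInformed_cylSrcRep_sub_quarter_mem_relations K hKc
  have h2 := soloInformed_cylSrcRep_sub_tgtRep_mem_relations K hKc
  have h3 := soloInformed_cylProdRep_sub_tgtRep_mem_relations K hKc hK0
  have h4 : of soloInformedArctanRep * (of (soloInformedRadialRep K hKc) -
      of (soloInformedFlatRep K hKc)) ∈ relations :=
    mul_mem_relations_left_holds _ _ (soloInformed_radialRep_sub_flatRep_mem_relations K hKc hK0)
  have hP : of (soloInformedCylProdRep K hKc) =
      of soloInformedArctanRep * of (soloInformedRadialRep K hKc) := by
    rw [soloInformedCylProdRep, of_mul_of]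
  rw [mul_sub, ← hP] at h4
  have e : of (soloInformedRevQuarterRep 1 1 K hKc) -
      of soloInformedArctanRep * of (soloInformedFlatRep K hKc) =
      -(of (soloInformedCylSrcRep K hKc) - of (soloInformedRevQuarterRep 1 1 K hKc)) +
      (of (soloInformedCylSrcRep K hKc) - of (soloInformedCylTgtRep K hKc)) -
      (of (soloInformedCylProdRep K hKc) - of (soloInformedCylTgtRep K hKc)) +
      (of (soloInformedCylProdRep K hKc) -
        of soloInformedArctanRep * of (soloInformedFlatRep K hKc)) := by abel
  rw [e]
  exact relations.add_mem (relations.sub_mem (relations.add_mem (relations.neg_mem h1) h2) h3) h4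

/-- **Pappus–Guldin inside the Kontsevich–Zagier calculus.** For a planar representation `K` with
compact domain in `{u ≥ 0}`, the solid of revolution `[Rev K, 1]` is KZ-equivalent to the cylinder
`[D̄ × Λ K, 1]` over the flattened profile `Λ K = {(u², z) | (u, z) ∈ K}`; in particular
`vol(Rev K) = π · area(Λ K) = 2π ∫_K u du dz`. [Kontsevich–Zagier 2001, §1.2 (rules);
Pappus' centroid theorem] -/
theorem soloInformed_revRep_equivalent_piRep_prod_flatRep (K : IntegralRep 2)
    (hKc : IsCompact K.domain) (hK0 : K.domain ⊆ {y | 0 ≤ y 0}) :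
    Equivalent (soloInformedRevRep K hKc) (piRep.prod (soloInformedFlatRep K hKc)) := by
  have h1 := soloInformed_revRep_sub_four_nsmul_quarter_mem_relations K hKc
  have h2 := soloInformed_quarter_sub_arctan_mul_flat_mem_relations K hKc hK0
  have h3 : (of piRep - 4 • of soloInformedArctanRep) * of (soloInformedFlatRep K hKc) ∈
      relations :=
    mul_mem_relations_right_holds _ _ soloInformed_piRep_sub_four_nsmul_arctanRep_mem_relations
  rw [sub_mul, smul_mul_assoc] at h3
  show of (soloInformedRevRep K hKc) - of (piRep.prod (soloInformedFlatRep K hKc)) ∈ relations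
  rw [← of_mul_of]
  have e : of (soloInformedRevRep K hKc) - of piRep * of (soloInformedFlatRep K hKc) =
      (of (soloInformedRevRep K hKc) - 4 • of (soloInformedRevQuarterRep 1 1 K hKc)) +
      4 • (of (soloInformedRevQuarterRep 1 1 K hKc) -
        of soloInformedArctanRep * of (soloInformedFlatRep K hKc)) -
      (of piRep * of (soloInformedFlatRep K hKc) -
        4 • (of soloInformedArctanRep * of (soloInformedFlatRep K hKc))) := by abel
  rw [e]
  exact relations.sub_mem (relations.add_mem h1 (relations.nsmul_mem h2 4)) h3

/-- The volume of a solid of revolution: `vol(Rev K) = π · vol(Λ K)`. -/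
theorem soloInformed_value_revRep (K : IntegralRep 2) (hKc : IsCompact K.domain)
    (hK0 : K.domain ⊆ {y | 0 ≤ y 0}) :
    (soloInformedRevRep K hKc).value = Real.pi * (soloInformedFlatRep K hKc).value := by
  rw [← IntegralRep.value_piRep_prod]
  exact Equivalent.value_eq_holds (soloInformed_revRep_equivalent_piRep_prod_flatRep K hKc hK0)

/-! ### Volume rung 3 for solids of revolution -/

/-- **Volume rung `3` for solids of revolution about a common axis** (granted the Huber–Wüstholz
theorem on curve periods, through volume rung `2`): if two solids of revolution of compact regions
with non-empty interior in the half-plane `{u ≥ 0}` have the same volume, they are KZ-equivalent.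
Proof: by Pappus in the calculus both are equivalent to cylinders `D̄ × Λ K`, `D̄ × Λ K'`; equal
volumes give `area(Λ K) = area(Λ K')`, so `Λ K ∼ Λ K'` by volume rung `2`
(`soloInformed_volumeRung_le_two`), and `relations` is an ideal. No disc cancellation is used. -/
theorem soloInformed_revolution_equivalent_of_value_eq (hHW : HuberWustholzCurvePeriods)
    (K K' : IntegralRep 2) (hKc : IsCompact K.domain) (hKi : (interior K.domain).Nonempty)
    (hK0 : K.domain ⊆ {y | 0 ≤ y 0}) (hKc' : IsCompact K'.domain)
    (hKi' : (interior K'.domain).Nonempty) (hK0' : K'.domain ⊆ {y | 0 ≤ y 0})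
    (h : (soloInformedRevRep K hKc).value = (soloInformedRevRep K' hKc').value) :
    Equivalent (soloInformedRevRep K hKc) (soloInformedRevRep K' hKc') := by
  have hP := soloInformed_revRep_equivalent_piRep_prod_flatRep K hKc hK0
  have hP' := soloInformed_revRep_equivalent_piRep_prod_flatRep K' hKc' hK0'
  have hv : (soloInformedFlatRep K hKc).value = (soloInformedFlatRep K' hKc').value := by
    have h1 := soloInformed_value_revRep K hKc hK0
    have h2 := soloInformed_value_revRep K' hKc' hK0'
    exact mul_left_cancel₀ Real.pi_ne_zero (by rw [← h1, ← h2, h])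
  have hF := soloInformed_isVolumeRep_flatRep K hKc hKi hK0
  have hF' := soloInformed_isVolumeRep_flatRep K' hKc' hKi' hK0'
  have hE : Equivalent (soloInformedFlatRep K hKc) (soloInformedFlatRep K' hKc') :=
    soloInformed_volumeRung_le_two hHW le_rfl _ _ hF.1 hF.2.1 hF'.1 hF'.2.1 hF.2.2 hF'.2.2 hv
  have hmid : of (piRep.prod (soloInformedFlatRep K hKc)) -
      of (piRep.prod (soloInformedFlatRep K' hKc')) ∈ relations := by
    rw [← soloInformed_of_piRep_mul_sub]
    exact mul_mem_relations_left_holds _ _ hE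
  show of (soloInformedRevRep K hKc) - of (soloInformedRevRep K' hKc') ∈ relations
  have e : of (soloInformedRevRep K hKc) - of (soloInformedRevRep K' hKc') =
      (of (soloInformedRevRep K hKc) - of (piRep.prod (soloInformedFlatRep K hKc))) +
      (of (piRep.prod (soloInformedFlatRep K hKc)) -
        of (piRep.prod (soloInformedFlatRep K' hKc'))) -
      (of (soloInformedRevRep K' hKc') - of (piRep.prod (soloInformedFlatRep K' hKc'))) := by
    abel
  rw [e]
  exact relations.sub_mem (relations.add_mem hP hmid) hP'

end Summit.KontsevichZagierPeriods.KontsevichZagierPeriods.Theorems
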